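import Summits.HubbardSuperconductivity.HubbardLadder.ClusterCutBlocks
import HarnessLib

/-!
# Cluster pair-cuts: the integer pair list of cut adv15_it2_s6 (`cut_oct12_adv15oct12it2.json` fd86203be9a8ff63, σ_road = −112463/500000 = the file's certified σ rounded down to 10⁻⁶)

HONEST FRAMING: ladder R1–R4 with certified numbers; no claim on H/H₀.  Cell pub-hubbard, lane r2-eng-1 (g14; g13 generators `adv06cert-g13/gen/`).  Kernel-side data of the cut
(`DEN = 10⁶`): the integer pair list `adv15it2P` (one orientation `(i, j, DEN·a_o)` per pair of orbit `o`, sites in the order of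
`Oct12Representation`) and `pairsOK 12 adv15it2P` (kernel).  The per-piece kernel certificates `ClusterCutOct12Adv15It2FrameNN` are stated for
`pairOp adv15it2P`; the identity with the cut's symmetric weight table (`= 2 • pairOp adv15it2P`) belongs with the row assembly.  All statements [folklore].
-/

namespace Summit.HubbardSuperconductivity.HubbardLadder.ClusterCut

open Matrix Literature.MathematicalPhysics.QuantumLattice

/-- The integer pair list of cut adv15_it2_s6: one orientation `(i, j, DEN·a_o)` per pair of orbit `o` (`DEN = 10⁶`; 56 pairs). -/
def adv15it2P : NatPairList :=
  [(0, 1, -528), (0, 2, 13342), (0, 3, 47485), (0, 5, -4635), (0, 6, -4635), (0, 7, -416),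
   (0, 8, -14023), (0, 9, -3493), (0, 10, -6593), (0, 11, -913), (1, 2, -4635), (1, 4, 47485),
   (1, 5, 13342), (1, 6, -3493), (1, 7, -14023), (1, 8, -416), (1, 9, -4635), (1, 10, -913),
   (1, 11, -6593), (2, 3, 47485), (2, 4, -416), (2, 5, -6593), (2, 6, -528), (2, 8, -14023),
   (2, 9, -913), (2, 10, -4635), (2, 11, -3493), (3, 4, 92013), (3, 5, -416), (3, 7, 92013),
   (3, 9, -14023), (3, 10, -416), (3, 11, -14023), (4, 5, 47485), (4, 6, -14023), (4, 8, 92013),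
   (4, 10, -14023), (4, 11, -416), (5, 6, -913), (5, 7, -14023), (5, 9, -528), (5, 10, -3493),
   (5, 11, -4635), (6, 7, 47485), (6, 8, -416), (6, 9, -6593), (6, 10, 13342), (6, 11, -4635),
   (7, 8, 92013), (7, 9, -416), (7, 10, 47485), (8, 9, 47485), (8, 11, 47485), (9, 10, -4635),
   (9, 11, 13342), (10, 11, -528)]

/-- Kernel: in every pair of `adv15it2P` the sites are `< 12` and distinct. -/
theorem adv15it2P_ok : pairsOK 12 adv15it2P = true := by decide

end Summit.HubbardSuperconductivity.HubbardLadder.ClusterCut
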